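import Mathlib
import Summits.NavierStokesRegularity.NavierStokesRegularity.Theorems.StretchingWellBindingTypeIBridgeTools
import Summits.NavierStokesRegularity.NavierStokesRegularity.Theses.HalfHolderEnergy
import HarnessLib

/-!
# `HalfHolderEnergy.HolderBridge` — the window quarter law runs the Type-I bridge
  (item stmt-NavierStokesRegularity-25162)

**Statement.** `ν > 0`, `T > 0`, `(u, p)` a MAXIMAL classical solution on `ℝ³ × [0, T)` (no
classical extension past `T`), Leray–Hopf on `[0, T]` from a rapidly decaying datum, with the
WINDOW law `∫_a^b ∫ |curl u|² ≤ K √(b − a)` for all `0 ≤ a ≤ b ≤ T`. Then some suitable weak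
solution of the unit-viscosity system has a local Type-I singular point in the sense of
Albritton–Barker 2019 (`IsLocalTypeISingularPoint r₀ z v q`).

PROOF (the item's plan; verbatim the tree's `Theorems.stretchingWellBinding_typeIBridge_proof`
— `StretchingWellBindingTypeIBridge.lean`, item 10521 — with the SLICE bound replaced by the
WINDOW bound, which is all the scaled dissipation ever reads).
1. *A bad point* (`TypeIBridge.exists_not_isBackwardBoundedAt`): a maximal classical Leray–Hopf
   solution is not backward bounded at some `(T, x₀)`.
2. *The zoom* `v = α u ∘ Φ`, `π = α² q ∘ Φ`, `Φ(s, y) = (T + βs, x₀ + Ry)`, `R = √(νT)`,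
   `α = R/ν`, `β = R²/ν ≤ T`, `q` the gauged pressure, is a suitable weak solution in `Q(0, 1)`
   with the zoomed classical gradient as weak gradient (verbatim the tree's block).
3. *Scaled dissipation from the window law.* A parabolic sub-ball `Q(z', r) ⊆ Q(0, 1)` is the
   `Φ`-preimage of the physical cylinder `(T + β(s₀ − r²), T + βs₀) × B(x₀ + Rz'.2, Rr)`
   (`s₀ = z'.1 ≤ 0`, `s₀ − r² ≥ −1`), so by the change of variables
   (`setLIntegral_frobeniusNormSq_stRescale`), Tonelli, the whole-space div–curl estimate
   `∫ |∇u|² ≤ ∫ |curl u|²` and the window law on `[T + β(s₀ − r²), T + βs₀] ⊆ [0, T]`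
   (length `βr²`): `∫∫_{Q(z',r)} |∇v|² ≤ (αR)² (βR³)⁻¹ · K √β · r`, i.e. `E(Q(z', r)) ≤ K'`
   uniformly in the sub-ball.
4. *Albritton–Barker Lemma 2.6*, `E`-case (`albrittonBarker2019_lemma_2_6_holds.of_cknE_le`):
   `𝐈(Q(0, 1/2)) < ∞`; the bad point makes the origin a backward singular point of `v`
   (`SereginSverak2002.isBackwardBoundedAt_of_zoom`); shrink to `Q(0, 1/2)`.

HONEST FRAMING: a bookkeeping bridge between two formulations of a HYPOTHETICAL blow-up (energy
½-Hölder up to the blow-up time vs. Albritton–Barker's local Type-I class); no blow-up is asserted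
to exist, and the window law `EnergyHalfHolder` is an OPEN crux of the route. Nothing here bears on
the regularity problem itself.
-/

noncomputable section

set_option linter.dupNamespace false

namespace Summit.NavierStokesRegularity.NavierStokesRegularity.Theorems

open MeasureTheory Set Filter Topology Metric Function Literature.Analysis.FluidPDE
open scoped NNReal ENNReal

namespace HolderBridge

variable {ν T : ℝ} {u : ℝ → (EuclideanSpace ℝ (Fin 3)) → (EuclideanSpace ℝ (Fin 3))} {p : ℝ → (EuclideanSpace ℝ (Fin 3)) → ℝ}

/-- **Scaled dissipation from a space–time bound**: if `∫∫_{Q(z, r)} |G|² ≤ K·r` then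
`E(Q(z, r)) = r⁻¹ ∫∫_{Q(z,r)} |G|² ≤ K`. [folklore] -/
theorem cknE_le_of_lintegral_le (z : ℝ × (EuclideanSpace ℝ (Fin 3)))
    {G : ℝ → (EuclideanSpace ℝ (Fin 3)) → (EuclideanSpace ℝ (Fin 3)) →L[ℝ] (EuclideanSpace ℝ (Fin 3))}
    {r K : ℝ} (hr : 0 < r)
    (h : ∫⁻ w in parabolicCylinder r z, ENNReal.ofReal (frobeniusNormSq (G w.1 w.2)) ≤
      ENNReal.ofReal (K * r)) :
    cknE r z G ≤ ENNReal.ofReal K := by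
  have hr0 : ENNReal.ofReal r ≠ 0 := by simpa using hr
  unfold cknE
  calc (ENNReal.ofReal r)⁻¹ * ∫⁻ w in parabolicCylinder r z, ENNReal.ofReal (frobeniusNormSq (G w.1 w.2))
      ≤ (ENNReal.ofReal r)⁻¹ * ENNReal.ofReal (K * r) := by gcongr
    _ = ENNReal.ofReal K := by
        rw [show K * r = r * K by ring, ENNReal.ofReal_mul hr.le, ← mul_assoc,
          ENNReal.inv_mul_cancel hr0 ENNReal.ofReal_ne_top, one_mul]

/-- **The window law bounds the physical dissipation of a final cylinder**: for a classical
Leray–Hopf solution on `[0, T)` with `∫_a^b ∫ |curl u|² ≤ K √(b − a)` (`0 ≤ a ≤ b ≤ T`), every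
cylinder `(a, b) × B` with `0 ≤ a ≤ b ≤ T` has `∫∫ |∇u|²_F ≤ K √(b − a)` (Tonelli + the
whole-space div–curl estimate `∫ |∇u(t)|² ≤ ∫ |curl u(t)|²` for the divergence-free finite-energy
`C²` slices). [cite: Leray1934, §20; AlbrittonBarker2019, §2] -/
theorem lintegral_cylinder_frobeniusNormSq_le_of_window (hν : 0 < ν)
    (hsol : IsClassicalNSSolutionOn (Ico 0 T) ν 0 u p) (hLH : IsLerayHopfOn T ν 0 (u 0) u)
    {K a b : ℝ} (ha : 0 ≤ a) (hbT : b ≤ T)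
    (hwin : ∫⁻ t in Ioo a b, ∫⁻ x, ‖curl (u t) x‖ₑ ^ 2 ≤ ENNReal.ofReal (K * Real.sqrt (b - a)))
    (B : Set (EuclideanSpace ℝ (Fin 3))) :
    ∫⁻ z in Ioo a b ×ˢ B, ENNReal.ofReal (frobeniusNormSq (fderiv ℝ (u z.1) z.2)) ≤
      ENNReal.ofReal (K * Real.sqrt (b - a)) := by
  have hμ : (volume.restrict (Ioo a b ×ˢ B) : Measure (ℝ × (EuclideanSpace ℝ (Fin 3)))) =
      (volume.restrict (Ioo a b)).prod (volume.restrict B) := by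
    rw [Measure.volume_eq_prod, Measure.prod_restrict]
  rw [hμ]
  refine (lintegral_prod_le _).trans (le_trans ?_ hwin)
  refine setLIntegral_mono_ae' measurableSet_Ioo (ae_of_all _ fun t ht => ?_)
  have htI : t ∈ Ico 0 T := ⟨ha.trans ht.1.le, lt_of_lt_of_le ht.2 hbT⟩
  have hC2 : ContDiff ℝ 2 (u t) := (hsol.contDiff_velocity htI).of_le (by norm_cast)
  have hL2 : ∫⁻ x, ‖u t x‖ₑ ^ 2 < ⊤ :=
    lt_of_le_of_lt (SereginSverak2002.eEnergy_le hν.le hLH ⟨htI.1, htI.2.le⟩) ENNReal.ofReal_lt_top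
  have h1 := lintegral_frobeniusNormSq_fderiv_le_lintegral_sq_norm_curl hC2 (hsol.divFree t htI) hL2
  have h2 : ∫⁻ y in B, ENNReal.ofReal (frobeniusNormSq (fderiv ℝ (u t) y)) ≤
      ∫⁻ y, ENNReal.ofReal (frobeniusNormSq (fderiv ℝ (u t) y)) := setLIntegral_le_lintegral _ _
  exact h2.trans h1

/-- **The viscosity-normalising zoom about a final-time point is locally Type I, under the
window law.** For a classical solution on `[0, T)` (viscosity `ν > 0`), Leray–Hopf on `[0, T]`,
with `∫_a^b ∫ |curl u|² ≤ K √(b − a)` for `0 ≤ a ≤ b ≤ T`, and any `x₀`, there are `R, α, β > 0`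
(`β ≤ T`) such that the pair `v = α u ∘ Φ`, `π = α² q ∘ Φ` is a suitable weak solution of the
unit-viscosity system in `Q(0, 1)` with the zoomed classical gradient as weak gradient and
`𝐈(Q(0, 1/2)) < ⊤`: the scaled dissipation `E` is bounded on all parabolic sub-balls of `Q(0,1)`
(each is the preimage of a physical cylinder over a time window of length `βr²` inside `[0, T]`,
where the window law pays `K √β r`), and the tree's `albrittonBarker2019_lemma_2_6_holds` (E-case)
bounds `A, C, D`. [cite: AlbrittonBarker2019, Lemma 2.6 and Def. 2.1] -/
theorem exists_zoom_typeIBound_lt_top_of_window (hν : 0 < ν) (hT : 0 < T)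
    (hsol : IsClassicalNSSolutionOn (Ico 0 T) ν 0 u p) (hLH : IsLerayHopfOn T ν 0 (u 0) u)
    (hwin : ∃ K : ℝ, ∀ a b : ℝ, 0 ≤ a → a ≤ b → b ≤ T →
      ∫⁻ t in Ioo a b, ∫⁻ x, ‖curl (u t) x‖ₑ ^ 2 ≤ ENNReal.ofReal (K * Real.sqrt (b - a)))
    (x₀ : (EuclideanSpace ℝ (Fin 3))) :
    ∃ R α β : ℝ, 0 < R ∧ 0 < α ∧ 0 < β ∧ β ≤ T ∧
      IsSuitableWeakSolutionInBall 1 0 (α • stPull β R T x₀ u)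
        (α ^ 2 • stPull β R T x₀ fun t x => p t x - (p t 0 - normalisedPressure (u t) 0)) ∧
      HasWeakSpatialGradientOn (parabolicCylinderOpens 1 (0 : ℝ × (EuclideanSpace ℝ (Fin 3)))) (α • stPull β R T x₀ u)
        ((α * R) • stPull β R T x₀ fun t x => fderiv ℝ (u t) x) ∧
      typeIBound (parabolicCylinder (1 / 2) (0 : ℝ × (EuclideanSpace ℝ (Fin 3)))) (α • stPull β R T x₀ u)
        (α ^ 2 • stPull β R T x₀ fun t x => p t x - (p t 0 - normalisedPressure (u t) 0))
        ((α * R) • stPull β R T x₀ fun t x => fderiv ℝ (u t) x) < ⊤ := by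
  obtain ⟨K₀, hK₀⟩ := hwin
  set K : ℝ := max K₀ 0 with hKdef
  have hK0 : 0 ≤ K := le_max_right _ _
  have hKw : ∀ a b : ℝ, 0 ≤ a → a ≤ b → b ≤ T →
      ∫⁻ t in Ioo a b, ∫⁻ x, ‖curl (u t) x‖ₑ ^ 2 ≤ ENNReal.ofReal (K * Real.sqrt (b - a)) :=
    fun a b ha hab hb => (hK₀ a b ha hab hb).trans (ENNReal.ofReal_le_ofReal
      (mul_le_mul_of_nonneg_right (le_max_left _ _) (Real.sqrt_nonneg _)))
  -- scales: `R² / ν ≤ T`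
  set R : ℝ := Real.sqrt (ν * T) with hR
  have hRpos : 0 < R := Real.sqrt_pos.2 (by positivity)
  set α : ℝ := R / ν with hα
  set β : ℝ := R ^ 2 / ν with hβdef
  have hαpos : 0 < α := by positivity
  have hβpos : 0 < β := by positivity
  have hβeq : β = α * R := by rw [hβdef, hα]; field_simp
  have hβT : β ≤ T := by
    have h2 : R ^ 2 = ν * T := Real.sq_sqrt (by positivity)
    rw [hβdef, div_le_iff₀ hν]; linarith
  refine ⟨R, α, β, hRpos, hαpos, hβpos, hβT, ?_⟩
  -- the gauged pressure
  set q : ℝ → (EuclideanSpace ℝ (Fin 3)) → ℝ := fun t x => p t x - (p t 0 - normalisedPressure (u t) 0) with hq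
  -- the `ν`-cylinder `(T - β, T) × B(x₀, R)` inside the slab, and its preimage `Q(0,1)`
  set PO : TopologicalSpace.Opens (ℝ × (EuclideanSpace ℝ (Fin 3))) :=
    ⟨Ioo (T - β) T ×ˢ ball x₀ R, isOpen_Ioo.prod isOpen_ball⟩ with hPO
  have hPOslab : (PO : Set (ℝ × (EuclideanSpace ℝ (Fin 3)))) ⊆ Ioo 0 T ×ˢ (univ : Set (EuclideanSpace ℝ (Fin 3))) := by
    rintro ⟨t, x⟩ ⟨ht, -⟩
    exact ⟨⟨by linarith [ht.1], ht.2⟩, mem_univ _⟩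
  have hpre1 : stPreimage β R T x₀ PO = parabolicCylinderOpens 1 (0 : ℝ × (EuclideanSpace ℝ (Fin 3))) := by
    apply TopologicalSpace.Opens.ext
    rw [coe_stPreimage]
    have h := stAffine_preimage_cylinder_eq_parabolicCylinder hν hRpos T x₀ R
    rw [div_self hRpos.ne'] at h
    exact h
  -- suitability of the zoom on `Q(0,1)` with unit viscosity
  have hsuit1 : IsSuitableWeakSolutionOn (parabolicCylinderOpens 1 (0 : ℝ × (EuclideanSpace ℝ (Fin 3)))) 1 0
      (α • stPull β R T x₀ u) (α ^ 2 • stPull β R T x₀ q) := by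
    have h0 := (SereginSverak2002.isSuitableWeakSolutionOn_gauge_of_classical hν hT hsol hLH PO
      hPOslab).stRescale hαpos hRpos hβeq T x₀
    have hvisc : α * ν / R = 1 := by rw [hα, div_mul_cancel₀ R hν.ne', div_self hRpos.ne']
    have hforce : ((α ^ 2 * R) • stPull β R T x₀ (0 : ℝ → (EuclideanSpace ℝ (Fin 3)) → (EuclideanSpace ℝ (Fin 3)))) = 0 := by
      funext s y; simp [stPull]
    rw [hvisc, hforce, hpre1] at h0
    exact h0
  -- the zoomed classical gradient
  have hGu : HasWeakSpatialGradientOn PO u fun t x => fderiv ℝ (u t) x :=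
    hasWeakSpatialGradientOn_of_contDiffOn isOpen_Ioo hPOslab
      ((SereginSverak2002.classical_Ioo hsol).smooth_velocity.of_le (by norm_cast))
  have hGv : HasWeakSpatialGradientOn (parabolicCylinderOpens 1 (0 : ℝ × (EuclideanSpace ℝ (Fin 3))))
      (α • stPull β R T x₀ u) ((α * R) • stPull β R T x₀ fun t x => fderiv ℝ (u t) x) := by
    rw [← hpre1]
    exact hGu.stRescale α hβpos hRpos T x₀
  -- the class `IsSuitableWeakSolutionInBall 1 0`
  have hball : IsSuitableWeakSolutionInBall 1 0 (α • stPull β R T x₀ u)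
      (α ^ 2 • stPull β R T x₀ q) := by
    refine ⟨hsuit1, ?_, ⟨_, hGv, ?_⟩, ?_⟩
    · -- energy class
      set CE : ENNReal := ENNReal.ofReal (2 * VectorCalculus.kineticEnergy (u 0)) with hCE
      have hphys : ∀ᵐ t ∂(volume.restrict (Ioo (T + β * (-1)) (T + β * 0))),
          ∫⁻ x in ball x₀ R, ‖u t x‖ₑ ^ 2 ≤ CE := by
        refine (ae_restrict_mem measurableSet_Ioo).mono fun t ht => ?_
        have htI : t ∈ Icc 0 T :=
          ⟨by nlinarith [ht.1], by have := ht.2; simp at this; exact this.le⟩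
        exact (setLIntegral_le_lintegral _ _).trans (SereginSverak2002.eEnergy_le hν.le hLH htI)
      have h2 := ae_sliced_setLIntegral_ball_stRescale hβpos hRpos T x₀ x₀ R (-1) 0
        (fun t x => ‖u t x‖ₑ ^ 2) hphys
      rw [finrank_euclideanSpace_fin, sub_self, smul_zero, div_self hRpos.ne'] at h2
      set C₁ : ENNReal := ‖α‖ₑ ^ 2 * (ENNReal.ofReal (R ^ 3)⁻¹ * CE) with hC₁
      have hC₁top : C₁ ≠ ⊤ :=
        ENNReal.mul_ne_top (by simp) (ENNReal.mul_ne_top ENNReal.ofReal_ne_top ENNReal.ofReal_ne_top)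
      refine ⟨C₁.toNNReal, ?_⟩
      rw [ENNReal.coe_toNNReal hC₁top]
      have hset : Ioo ((0 : ℝ × (EuclideanSpace ℝ (Fin 3))).1 - 1 ^ 2) (0 : ℝ × (EuclideanSpace ℝ (Fin 3))).1 = Ioo (-1 : ℝ) 0 := by simp
      rw [hset]
      filter_upwards [h2] with s hs
      have e : ∀ y : (EuclideanSpace ℝ (Fin 3)), ‖(α • stPull β R T x₀ u) s y‖ₑ ^ 2 =
          ‖α‖ₑ ^ 2 * ‖u (T + β * s) (x₀ + R • y)‖ₑ ^ 2 := by
        intro y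
        rw [smul_stPull_apply, enorm_smul, mul_pow]
      simp only [e]
      rw [lintegral_const_mul' _ _ (by simp)]
      exact mul_le_mul' le_rfl hs
    · -- `∫_{Q(0,1)} |∇v|² < ⊤`
      have hpre : parabolicCylinder 1 (0 : ℝ × (EuclideanSpace ℝ (Fin 3))) =
          stAffine β R T x₀ ⁻¹' (Ioo (T - (R * 1) ^ 2 / ν) T ×ˢ ball x₀ (R * 1)) := by
        rw [hβdef, stAffine_preimage_cylinder_eq_parabolicCylinder hν hRpos T x₀ (R * 1),
          mul_div_cancel_left₀ (1 : ℝ) hRpos.ne']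
        rfl
      rw [hpre, setLIntegral_frobeniusNormSq_stRescale hβpos hRpos T x₀ (α * R),
        finrank_euclideanSpace_fin]
      refine ENNReal.mul_lt_top (ENNReal.mul_lt_top ENNReal.ofReal_lt_top ENNReal.ofReal_lt_top) ?_
      refine lt_of_le_of_lt (lintegral_mono_set ?_)
        (SereginSverak2002.lintegral_slab_frobeniusNormSq_fderiv_lt_top' hsol hLH)
      rw [mul_one]
      rintro ⟨t, x⟩ ⟨ht, -⟩
      refine ⟨⟨?_, ht.2⟩, mem_univ _⟩
      have : R ^ 2 / ν = β := rfl
      linarith [ht.1]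
    · -- `π ∈ L^{3/2}(Q(0,1))`
      refine ⟨hsuit1.distributional.2.2.1.aestronglyMeasurable, ?_⟩
      have h32 : ((3 : ENNReal) / 2).toReal = 3 / 2 := by rw [ENNReal.toReal_div]; norm_num
      have h32top : (3 : ENNReal) / 2 ≠ ⊤ := (ENNReal.div_lt_top (by simp) (by simp)).ne
      rw [eLpNorm_eq_lintegral_rpow_enorm_toReal (by norm_num) h32top, h32]
      refine ENNReal.rpow_lt_top_of_nonneg (by positivity) (ne_of_lt ?_)
      have hQ1 : parabolicCylinder 1 (0 : ℝ × (EuclideanSpace ℝ (Fin 3))) = stAffine β R T x₀ ⁻¹' (PO : Set (ℝ × (EuclideanSpace ℝ (Fin 3)))) := by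
        rw [← coe_stPreimage, hpre1]; rfl
      rw [hQ1]
      show ∫⁻ z in stAffine β R T x₀ ⁻¹' (PO : Set (ℝ × (EuclideanSpace ℝ (Fin 3)))),
          ‖(α ^ 2 • stPull β R T x₀ q) z.1 z.2‖ₑ ^ (3 / 2 : ℝ) < ⊤
      rw [setLIntegral_enorm_rpow_stRescale hβpos hRpos T x₀ (α ^ 2) q _ (by norm_num)]
      refine ENNReal.mul_lt_top (ENNReal.mul_lt_top
        (ENNReal.rpow_lt_top_of_nonneg (by norm_num) enorm_ne_top) ENNReal.ofReal_lt_top) ?_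
      exact lt_of_le_of_lt (lintegral_mono_set hPOslab)
        (SereginSverak2002.lintegral_slab_gauged_pressure_lt_top hν hT hsol hLH)
  -- Step 3: the scaled dissipation `E` on every parabolic sub-ball of `Q(0,1)` from the window law
  set Gv : ℝ → (EuclideanSpace ℝ (Fin 3)) → (EuclideanSpace ℝ (Fin 3)) →L[ℝ] (EuclideanSpace ℝ (Fin 3)) := (α * R) • stPull β R T x₀ fun t x => fderiv ℝ (u t) x with hGvdef
  set K' : ℝ := (α * R) ^ 2 * (β * R ^ 3)⁻¹ * Real.sqrt β * K with hK'def
  have hK'0 : 0 ≤ K' := by positivity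
  have hE : ∀ (r : ℝ) (z' : ℝ × (EuclideanSpace ℝ (Fin 3))), 0 < r →
      parabolicCylinder r z' ⊆ parabolicCylinder 1 (0 : ℝ × (EuclideanSpace ℝ (Fin 3))) →
      cknE r z' Gv ≤ ENNReal.ofReal K' := by
    intro r z' hr hz'
    obtain ⟨-, -, ht1, ht2, -⟩ := parabolicCylinder_subset_data hr hz'
    simp only [Prod.fst_zero, one_pow, zero_sub] at ht1 ht2
    -- the physical window `[a, b] = [T + β(s₀ - r²), T + β s₀] ⊆ [0, T]`, of length `β r²`
    set a : ℝ := T + β * (z'.1 - r ^ 2) with ha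
    set b : ℝ := T + β * z'.1 with hb
    have ha0 : 0 ≤ a := by
      have : β * (-1) ≤ β * (z'.1 - r ^ 2) := mul_le_mul_of_nonneg_left ht1 hβpos.le
      rw [ha]; linarith
    have hab : a ≤ b := by
      rw [ha, hb]
      have : β * (z'.1 - r ^ 2) ≤ β * z'.1 :=
        mul_le_mul_of_nonneg_left (by nlinarith) hβpos.le
      linarith
    have hbT : b ≤ T := by
      have : β * z'.1 ≤ 0 := mul_nonpos_of_nonneg_of_nonpos hβpos.le ht2
      rw [hb]; linarith
    have hba : b - a = β * r ^ 2 := by rw [ha, hb]; ring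
    -- `Q(z', r)` is the preimage of the physical cylinder `(a, b) × B(x₀ + R z'.2, R r)`
    have hpre : parabolicCylinder r z' =
        stAffine β R T x₀ ⁻¹' (Ioo a b ×ˢ ball (x₀ + R • z'.2) (R * r)) := by
      rw [stAffine_preimage_cylinder hβpos hRpos T x₀ (x₀ + R • z'.2) a b (R * r)]
      have e1 : (a - T) / β = z'.1 - r ^ 2 := by
        rw [ha]; field_simp; ring
      have e2 : (b - T) / β = z'.1 := by
        rw [hb]; field_simp; ring
      have e3 : R⁻¹ • (x₀ + R • z'.2 - x₀) = z'.2 := by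
        rw [add_sub_cancel_left, smul_smul, inv_mul_cancel₀ hRpos.ne', one_smul]
      have e4 : R * r / R = r := by field_simp
      rw [e1, e2, e3, e4]
      rfl
    refine cknE_le_of_lintegral_le z' hr ?_
    rw [hGvdef, hpre, setLIntegral_frobeniusNormSq_stRescale hβpos hRpos T x₀ (α * R),
      finrank_euclideanSpace_fin]
    -- the physical dissipation of the window, by the window law
    have hphys : ∫⁻ z in Ioo a b ×ˢ ball (x₀ + R • z'.2) (R * r),
        ENNReal.ofReal (frobeniusNormSq (fderiv ℝ (u z.1) z.2)) ≤
        ENNReal.ofReal (K * Real.sqrt (b - a)) :=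
      lintegral_cylinder_frobeniusNormSq_le_of_window hν hsol hLH ha0 hbT (hKw a b ha0 hab hbT) _
    refine (mul_le_mul' le_rfl hphys).trans (le_of_eq ?_)
    rw [hba, Real.sqrt_mul hβpos.le, Real.sqrt_sq hr.le,
      ← ENNReal.ofReal_mul (sq_nonneg _), ← ENNReal.ofReal_mul (by positivity), hK'def]
    congr 1
    ring
  -- Step 4: Albritton–Barker Lemma 2.6, `E`-case
  exact ⟨hball, hGv, albrittonBarker2019_lemma_2_6_holds.of_cknE_le hball hGv
    (M := K'.toNNReal) fun r z' hr hz' => by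
      show cknE r z' Gv ≤ ENNReal.ofReal K'
      exact hE r z' hr hz'⟩

end HolderBridge

open HolderBridge TypeIBridge in
/-- **Item stmt-NavierStokesRegularity-25162** (`HalfHolderEnergy.HolderBridge`): the window
quarter law `∫_a^b ∫ |curl u|² ≤ K √(b − a)` at the maximal time of a classical Leray–Hopf solution
from a rapidly decaying datum yields a local Type-I singular point of the unit-viscosity zoom about
a final-time point where `u` is not backward bounded. [cite: AlbrittonBarker2019, Thm. 1.1, Def. 2.1 and Lemma 2.6] -/
theorem halfHolderEnergy_holderBridge_proof :
    Summit.NavierStokesRegularity.NavierStokesRegularity.Theses.HalfHolderEnergy.HolderBridge := by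
  unfold Summit.NavierStokesRegularity.NavierStokesRegularity.Theses.HalfHolderEnergy.HolderBridge
  intro ν T hν hT u p hmax hLH _hdec hwin
  obtain ⟨x₀, hx₀⟩ := exists_not_isBackwardBoundedAt hν hT hmax hLH
  obtain ⟨R, α, β, hR, hα, hβ, hβT, hball, hGv, htypeI⟩ :=
    exists_zoom_typeIBound_lt_top_of_window hν hT hmax.1 hLH hwin x₀
  have hsing : IsBackwardSingularPoint (α • stPull β R T x₀ u) (0 : ℝ × EuclideanSpace ℝ (Fin 3)) := by
    intro r hr
    by_contra hfin
    have hfin' : eLpNorm (uncurry (α • stPull β R T x₀ u)) ⊤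
        (volume.restrict (parabolicCylinder (min r 1) (0 : ℝ × EuclideanSpace ℝ (Fin 3)))) < ⊤ := by
      refine lt_of_le_of_lt (eLpNorm_mono_measure _ (Measure.restrict_mono ?_ le_rfl))
        (lt_top_iff_ne_top.2 hfin)
      exact SuitableCompactness.parabolicCylinder_zero_mono (le_min hr.le zero_le_one) (min_le_left _ _)
    exact hx₀ (SereginSverak2002.isBackwardBoundedAt_of_zoom hmax.1 x₀ hR hα hβ hβT
      (lt_min hr one_pos) (min_le_right _ _) hfin')
  refine ⟨1 / 2, 0, α • stPull β R T x₀ u,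
    α ^ 2 • stPull β R T x₀ (fun t x => p t x - (p t 0 - normalisedPressure (u t) 0)),
    by norm_num, ?_, hsing, _,
    hGv.mono (SuitableCompactness.parabolicCylinderOpens_zero_mono (by norm_num) (by norm_num)),
    htypeI⟩
  exact SuitableCompactness.isSuitableWeakSolutionInBall_of_le_radius hball (by norm_num) (by norm_num)

end Summit.NavierStokesRegularity.NavierStokesRegularity.Theorems

end
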